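import Summits.Ventures.HodgeRepro2.T5SU11GaussLegendre
import Summits.Ventures.HodgeRepro2.T5SU11LegendreExpansion

/-!
# The Gauss–Legendre weights in closed form: `w_i = 2/((1 − x_i²) P'_{n+1}(x_i)²) = 2/((n + 1) P_n(x_i) P'_{n+1}(x_i))`

The reproducing kernel `K_n(x, y) = Σ_{k ≤ n} ((2k + 1)/2) P_k(x) P_k(y)` of row 409 reproduces every polynomial of
degree `≤ n`, in particular the Lagrange basis polynomial `ℓ_i` of the `n + 1` nodes: `∫ K_n(x, x_i) ℓ_i(x) dx = 1`.
The integrand has degree `2n ≤ 2(n + 1) − 1`, so Gauss–Legendre quadrature (row 408) computes the integral as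
`Σ_j w_j K_n(x_j, x_i) ℓ_i(x_j) = w_i K_n(x_i, x_i)`:

  **`w_i · K_n(x_i, x_i) = 1`**, i.e. **`w_i = 2 / Σ_{k ≤ n} (2k + 1) P_k(x_i)²`**   (`weight_mul_kernel_self`, `weight_eq_two_div_sum`),

the CHRISTOFFEL NUMBERS formula. The confluent Christoffel–Darboux formula (row 382) turns the sum into
`(n + 1)(P_n(x_i) P'_{n+1}(x_i) − P_{n+1}(x_i) P'_n(x_i)) = (n + 1) P_n(x_i) P'_{n+1}(x_i)` at a zero of `P_{n+1}`, and the
identity `(1 − x²) P'_{n+1} = (n + 1)(P_n − x P_{n+1})` gives `(1 − x_i²) P'_{n+1}(x_i) = (n + 1) P_n(x_i)`: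

  **`w_i = 2/((n + 1) P_n(x_i) P'_{n+1}(x_i)) = 2/((1 − x_i²) P'_{n+1}(x_i)²)`**   (`weight_eq_classical`, `weight_eq_classical'`),

the classical closed form of the Gauss–Legendre weights, with `(1 − x_i²) P'_{n+1}(x_i)² > 0` read off
(`one_sub_sq_mul_legQ_sq_pos`), and the DISCRETE ORTHOGONALITY `Σ_i w_i P_k(x_i) P_l(x_i) = 2δ_{kl}/(2k + 1)` for `k, l ≤ n`
(`sum_weight_mul_legP_mul_legP`). Nothing is claimed about (N).

Blind lane: Mathlib + the HodgeRepro2 prefix only; no sorry; axioms ⊆ {propext, Classical.choice,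
Quot.sound}.
-/

namespace Summit.Ventures.HodgeRepro2.T5SU11GaussLegendreWeights

open Polynomial intervalIntegral Finset Set
open T5SU11SphericalLegendreAll T5SU11JacobiPhaseLawEven T5SU11JacobiLegendreLeading T5SU11LegendreIdentities
  T5SU11LegendreOrthogonal T5SU11LegendreOrthogonalLower T5SU11LegendreZeros T5SU11GaussLegendre
  T5SU11LegendreExpansion

/-- The kernel `K_n(·, y)` as a polynomial: `kernelPoly n y = Σ_{k ≤ n} C((2k+1)/2 · P_k(y)) · legPoly k`. -/
noncomputable def kernelPoly (n : ℕ) (y : ℝ) : ℝ[X] :=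
  ∑ k ∈ range (n + 1), C ((2 * (k : ℝ) + 1) / 2 * legP k y) * legPoly k

/-- `(kernelPoly n y)(x) = K_n(x, y)`. -/
theorem eval_kernelPoly (n : ℕ) (y x : ℝ) : (kernelPoly n y).eval x = kernel n x y := by
  rw [kernelPoly, kernel, eval_finsetSum]
  refine Finset.sum_congr rfl fun k _ => ?_
  rw [eval_mul, eval_C, ← legP_eq_eval]
  ring

/-- `natDegree (kernelPoly n y) ≤ n`. -/
theorem natDegree_kernelPoly_le (n : ℕ) (y : ℝ) : (kernelPoly n y).natDegree ≤ n := by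
  refine (natDegree_sum_le_of_forall_le _ _ fun k hk => ?_)
  calc (C ((2 * (k : ℝ) + 1) / 2 * legP k y) * legPoly k).natDegree
      ≤ (C ((2 * (k : ℝ) + 1) / 2 * legP k y)).natDegree + (legPoly k).natDegree := natDegree_mul_le
    _ ≤ 0 + k := by rw [natDegree_C, natDegree_legPoly]
    _ ≤ n := by have := Finset.mem_range.mp hk; omega

/-- `K_n(x, x) = Σ_{k ≤ n} ((2k + 1)/2) P_k(x)² > 0`. -/
theorem kernel_self_pos (n : ℕ) (x : ℝ) : 0 < kernel n x x := by
  rw [kernel]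
  refine Finset.sum_pos' (fun k _ => mul_nonneg (by positivity) (mul_self_nonneg _))
    ⟨0, Finset.mem_range.mpr (Nat.succ_pos n), by simp⟩

/-! ### `w_i · K_n(x_i, x_i) = 1` -/

/-- **`∫_{−1}^{1} K_n(x, x_i) ℓ_i(x) dx = 1`** for a node `i` of an `(n+1)`-element node set. -/
theorem integral_kernel_mul_basis {n : ℕ} {s : Finset ℝ} (hcard : s.card = n + 1) {i : ℝ} (hi : i ∈ s) :
    ∫ x in (-1 : ℝ)..1, kernel n x i * (Lagrange.basis s id i).eval x = 1 := by
  have hinj : Set.InjOn (id : ℝ → ℝ) s := Set.injOn_id _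
  have hdeg : (Lagrange.basis s id i).natDegree ≤ n := by
    rw [Lagrange.natDegree_basis hinj hi, hcard]
    omega
  have h := integral_kernel_mul_eq hdeg i
  have h1 := Lagrange.eval_basis_self hinj hi
  simp only [id] at h1
  rw [h1] at h
  -- `K_n(i, y) ℓ_i(y)` vs `K_n(y, i) ℓ_i(y)`: the kernel is symmetric
  have hsymm : ∀ y, kernel n y i = kernel n i y := fun y => by
    rw [kernel, kernel]
    refine Finset.sum_congr rfl fun k _ => ?_
    ring
  simp_rw [hsymm]
  exact h

/-- **`w_i · K_n(x_i, x_i) = 1`** (Gauss–Legendre on `K_n(·, x_i) ℓ_i`, of degree `2n`). -/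
theorem weight_mul_kernel_self {n : ℕ} {s : Finset ℝ} (hcard : s.card = n + 1) (hs : ∀ r ∈ s, legP (n + 1) r = 0)
    {i : ℝ} (hi : i ∈ s) : weight s i * kernel n i i = 1 := by
  have hinj : Set.InjOn (id : ℝ → ℝ) s := Set.injOn_id _
  -- the integrand as a polynomial of degree `≤ 2n ≤ 2(n+1) − 1`
  set f : ℝ[X] := kernelPoly n i * Lagrange.basis s id i with hf
  have hfdeg : f.natDegree ≤ 2 * (n + 1) - 1 := by
    calc f.natDegree ≤ (kernelPoly n i).natDegree + (Lagrange.basis s id i).natDegree := natDegree_mul_le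
      _ ≤ n + n := by
          refine Nat.add_le_add (natDegree_kernelPoly_le n i) ?_
          rw [Lagrange.natDegree_basis hinj hi, hcard]
          omega
      _ ≤ 2 * (n + 1) - 1 := by omega
  have hG := gauss_legendre (Nat.succ_pos n) hcard hs hfdeg
  have hfev : ∀ x, f.eval x = kernel n x i * (Lagrange.basis s id i).eval x := fun x => by
    rw [hf, eval_mul, eval_kernelPoly]
  simp_rw [hfev] at hG
  rw [integral_kernel_mul_basis hcard hi, Finset.sum_eq_single i] at hG
  · have h1 := Lagrange.eval_basis_self hinj hi
    simp only [id] at h1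
    rw [h1, mul_one] at hG
    exact hG.symm
  · intro j hj hji
    have h2 := Lagrange.eval_basis_of_ne (v := id) (Ne.symm hji) hj
    simp only [id] at h2
    rw [h2, mul_zero, mul_zero]
  · intro h
    exact absurd hi h

/-- **THE CHRISTOFFEL NUMBERS**: `w_i = 2 / Σ_{k ≤ n} (2k + 1) P_k(x_i)²`. -/
theorem weight_eq_two_div_sum {n : ℕ} {s : Finset ℝ} (hcard : s.card = n + 1) (hs : ∀ r ∈ s, legP (n + 1) r = 0)
    {i : ℝ} (hi : i ∈ s) : weight s i = 2 / ∑ k ∈ range (n + 1), (2 * (k : ℝ) + 1) * legP k i ^ 2 := by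
  have h := weight_mul_kernel_self hcard hs hi
  have hK : kernel n i i = (∑ k ∈ range (n + 1), (2 * (k : ℝ) + 1) * legP k i ^ 2) / 2 := by
    rw [kernel, Finset.sum_div]
    refine Finset.sum_congr rfl fun k _ => ?_
    ring
  have hpos : 0 < ∑ k ∈ range (n + 1), (2 * (k : ℝ) + 1) * legP k i ^ 2 := by
    have := kernel_self_pos n i
    rw [hK] at this
    linarith
  rw [hK] at h
  field_simp
  linarith

/-! ### The classical closed forms -/

/-- `(1 − x²) P'_{n+1}(x) = (n + 1)(P_n(x) − x P_{n+1}(x))`. -/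
theorem one_sub_sq_mul_legQ_succ (n : ℕ) (x : ℝ) :
    (1 - x ^ 2) * legQ (n + 1) x = ((n : ℝ) + 1) * (legP n x - x * legP (n + 1) x) := by
  have h1 := (legendre_identities n x).1
  have h2 := mul_legQ_succ_sub_legQ n x
  linear_combination h1 - x * h2

/-- At a zero `x` of `P_{n+1}`: `Σ_{k ≤ n} (2k + 1) P_k(x)² = (n + 1) P_n(x) P'_{n+1}(x) = (1 − x²) P'_{n+1}(x)²`. -/
theorem sum_eq_at_root (n : ℕ) {x : ℝ} (hx : legP (n + 1) x = 0) :
    ∑ k ∈ range (n + 1), (2 * (k : ℝ) + 1) * legP k x ^ 2 = ((n : ℝ) + 1) * legP n x * legQ (n + 1) x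
      ∧ ((n : ℝ) + 1) * legP n x * legQ (n + 1) x = (1 - x ^ 2) * legQ (n + 1) x ^ 2 := by
  have hcd := christoffel_darboux_confluent n x
  have hid := one_sub_sq_mul_legQ_succ n x
  rw [hx] at hcd hid
  constructor
  · rw [hcd]; ring
  · rw [mul_zero, sub_zero] at hid
    linear_combination (-(legQ (n + 1) x)) * hid

/-- **`(1 − x_i²) P'_{n+1}(x_i)² > 0`** at a zero of `P_{n+1}` (it equals the positive Christoffel–Darboux sum). -/
theorem one_sub_sq_mul_legQ_sq_pos (n : ℕ) {x : ℝ} (hx : legP (n + 1) x = 0) : 0 < (1 - x ^ 2) * legQ (n + 1) x ^ 2 := by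
  have h := sum_eq_at_root n hx
  rw [← h.2, ← h.1]
  have := kernel_self_pos n x
  rw [kernel] at this
  have e : ∑ k ∈ range (n + 1), (2 * (k : ℝ) + 1) / 2 * (legP k x * legP k x)
      = (∑ k ∈ range (n + 1), (2 * (k : ℝ) + 1) * legP k x ^ 2) / 2 := by
    rw [Finset.sum_div]
    exact Finset.sum_congr rfl fun k _ => by ring
  rw [e] at this
  linarith

/-- **THE CLASSICAL FORMULA**: `w_i = 2/((1 − x_i²) P'_{n+1}(x_i)²)` at the zeros `x_i` of `P_{n+1}`. -/
theorem weight_eq_classical {n : ℕ} {s : Finset ℝ} (hcard : s.card = n + 1) (hs : ∀ r ∈ s, legP (n + 1) r = 0)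
    {i : ℝ} (hi : i ∈ s) : weight s i = 2 / ((1 - i ^ 2) * legQ (n + 1) i ^ 2) := by
  rw [weight_eq_two_div_sum hcard hs hi, (sum_eq_at_root n (hs i hi)).1, (sum_eq_at_root n (hs i hi)).2]

/-- **The other classical form**: `w_i = 2/((n + 1) P_n(x_i) P'_{n+1}(x_i))`. -/
theorem weight_eq_classical' {n : ℕ} {s : Finset ℝ} (hcard : s.card = n + 1) (hs : ∀ r ∈ s, legP (n + 1) r = 0)
    {i : ℝ} (hi : i ∈ s) : weight s i = 2 / (((n : ℝ) + 1) * legP n i * legQ (n + 1) i) := by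
  rw [weight_eq_two_div_sum hcard hs hi, (sum_eq_at_root n (hs i hi)).1]

/-- **Discrete orthogonality**: `Σ_{i ∈ s} w_i P_k(x_i) P_l(x_i) = 2δ_{kl}/(2k + 1)` for `k, l ≤ n` (Gauss–Legendre on
`P_k P_l`, of degree `≤ 2n`, and row 383). -/
theorem sum_weight_mul_legP_mul_legP {n : ℕ} {s : Finset ℝ} (hcard : s.card = n + 1)
    (hs : ∀ r ∈ s, legP (n + 1) r = 0) {k l : ℕ} (hk : k ≤ n) (hl : l ≤ n) :
    ∑ i ∈ s, weight s i * (legP k i * legP l i) = if k = l then 2 / (2 * (k : ℝ) + 1) else 0 := by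
  have hdeg : (legPoly k * legPoly l).natDegree ≤ 2 * (n + 1) - 1 := by
    calc (legPoly k * legPoly l).natDegree ≤ (legPoly k).natDegree + (legPoly l).natDegree := natDegree_mul_le
      _ ≤ 2 * (n + 1) - 1 := by rw [natDegree_legPoly, natDegree_legPoly]; omega
  have h := gauss_legendre (Nat.succ_pos n) hcard hs hdeg
  simp_rw [eval_mul, ← legP_eq_eval] at h
  rw [← h, integral_legP_mul_legP k l]
  split_ifs with hkl
  · rw [hkl]
  · rfl

/-- **Gauss–Legendre quadrature with the classical weights, packaged**: for `n + 1` nodes (the zeros of `P_{n+1}`),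
`∫_{−1}^{1} f = Σ_i 2 f(x_i)/((1 − x_i²) P'_{n+1}(x_i)²)` for every `f` of degree `≤ 2n + 1`. -/
theorem exists_gauss_legendre_rule_classical (n : ℕ) :
    ∃ s : Finset ℝ, s.card = n + 1 ∧ (∀ r ∈ s, r ∈ Ioo (-1 : ℝ) 1) ∧ (∀ r ∈ s, legP (n + 1) r = 0)
      ∧ ∀ f : ℝ[X], f.natDegree ≤ 2 * n + 1 →
        ∫ x in (-1 : ℝ)..1, f.eval x = ∑ i ∈ s, 2 / ((1 - i ^ 2) * legQ (n + 1) i ^ 2) * f.eval i := by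
  obtain ⟨s, hcard, hmem, hiff, -⟩ := legendre_zeros (n + 1)
  have hs : ∀ r ∈ s, legP (n + 1) r = 0 := fun r hr => (hiff r).mpr hr
  refine ⟨s, hcard, hmem, hs, fun f hf => ?_⟩
  rw [gauss_legendre (Nat.succ_pos n) hcard hs (by omega)]
  exact Finset.sum_congr rfl fun i hi => by rw [weight_eq_classical hcard hs hi]

end Summit.Ventures.HodgeRepro2.T5SU11GaussLegendreWeights
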